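import Mathlib
import Summits.NavierStokesRegularity.NavierStokesRegularity.Theses.FrozenSignCascade
import Summits.NavierStokesRegularity.NavierStokesRegularity.Theorems.FrozenSignCascadeTightEnvelopeContinuationAPriori
import Summits.NavierStokesRegularity.NavierStokesRegularity.Theorems.FrozenSignCascadeEnvelopeBoundStubMildUnique
import Summits.NavierStokesRegularity.NavierStokesRegularity.Theorems.FrozenSignCascadeEnvelopeBoundStubEnergyOfUnique
import Literature.Analysis.FluidPDE.NSFourierSobolev
import HarnessLib

/-!
# Route FrozenSignCascade · crux `EnvelopeBound` (stmt-NavierStokesRegularity-1549): reduction of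
  the crux to its high-frequency branch

Support file for the crux item stmt-NavierStokesRegularity-1549 (`EnvelopeBound`, rank 2 of route
`FrozenSignCascade`); lands `--supports` that item. It is the sorry-free part of the line lead's
skeleton `Cruxes/EnvelopeBound/Lines/birth.lean` (reshape r2), now that the two classical stubs of
the line have landed (`Registered.stub_mildUnique`, uniqueness in the Fourier-mild class;
`Registered.stub_energyOfUnique`, the energy inequality of Fourier-mild solutions).

**Theorems.**
* `energyIneq` — the ENERGY INEQUALITY of Fourier-side mild solutions, unconditionally:
  `∫ ∑ₗ ‖V(t,η)ₗ‖² dη ≤ ∫ ∑ₗ ‖V(t₀,η)ₗ‖² dη` on `[t₀,t₁]` for `IsFourierMild c K₀ t₀ t₁ V`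
  (`stub_energyOfUnique` fed with `stub_mildUnique`).
* `lowFreqOfEnergy`, `lowFrequencyControl` — LOW FREQUENCIES ARE OWNED BY THE ENERGY LEVEL: for
  every `ν > 0`, Clay datum `u₀`, horizon `T₀` and radius `R` there is `C(ν,u₀,T₀,R)` with
  `‖ξ‖² ‖V t ξ‖ ≤ C` for `‖ξ‖ ≤ R`, `t ∈ [0,T]`, along EVERY Fourier-mild solution `V` on `[0,T]`,
  `T ≤ T₀`, from the Fourier datum (Duhamel at `s = 0` and `‖N(V,V)(ξ)‖ ≤ 36π‖ξ‖·(energy)`, the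
  tree's `TightEnvelope.norm_le_of_energy`, closed by `energyIneq`; Lemarié-Rieusset 2016, proof
  of Thm. 8.21, low-frequency half).
* `envelopeBound_iff_highFrequencyBranch` — THE REDUCTION: the crux `EnvelopeBound` is EQUIVALENT
  to its high-frequency branch statement (the line's only open stub `stub_highFrequencyBranch`):
  "for every `ν, u₀, T₀` there are `R, C` such that whenever the datum admits some Fourier-mild
  solution on `[0,T]`, `T ≤ T₀`, it admits one whose envelope is bounded by `C` at frequencies
  `‖ξ‖ ≥ R`". Direction `←` is the line's composition (low frequencies by `lowFrequencyControl`,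
  high frequencies along the branch, transferred by uniqueness); direction `→` takes the branch to
  be the given solution. So after this file the crux carries exactly the content of the branch
  statement — a large-data, scale-critical (`PM²`-level) a-priori bound at high frequencies — and
  nothing else.
-/

noncomputable section

set_option linter.dupNamespace false -- nested layout Summit.<S>.<Sub>, Sub = S (D-0017)

open Set MeasureTheory Filter Topology
open Literature.Analysis.FluidPDE Literature.Analysis.FluidPDE.FourierNS

namespace Summit.NavierStokesRegularity.NavierStokesRegularity.Theorems.EnvelopeBound.Registered

/-- **The energy inequality of Fourier-side mild solutions** (unconditional): for `V` mild on
`[t₀,t₁]` (any heat rate `c > 0`, weight order `K₀ > 3`) the Fourier-side energy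
`∫ ∑ₗ ‖V(t,η)ₗ‖² dη` — the physical energy `‖u(t)‖²_{L²}` by Plancherel — does not exceed its
initial value on `[t₀,t₁]` (`stub_energyOfUnique` applied to `stub_mildUnique`; Leray 1934,
Lemarié-Rieusset 2016 Thm. 7.2 / Prop. 12.1). -/
theorem energyIneq :
    ∀ (c : ℝ) (K₀ : ℕ) (t₀ t₁ : ℝ) (V : ℝ → EuclideanSpace ℝ (Fin 3) → Fin 3 → ℂ),
      Literature.Analysis.FluidPDE.FourierNS.IsFourierMild c K₀ t₀ t₁ V →
      ∀ t ∈ Set.Icc t₀ t₁, ∫ η, ∑ l, ‖V t η l‖ ^ 2 ≤ ∫ η, ∑ l, ‖V t₀ η l‖ ^ 2 :=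
  stub_energyOfUnique stub_mildUnique

/-- **Low frequencies are owned by the energy level.** For every `ν > 0`, Clay datum `u₀`,
horizon `T₀ > 0` and radius `R` there is `C = C(ν,u₀,T₀,R)` such that along EVERY Fourier-mild
solution `V` on `[0,T]`, `T ≤ T₀`, from the Fourier datum `a` whose Fourier energy stays below
that of the datum (`∫∑ₗ‖V(t)ₗ‖² ≤ ∫∑ₗ‖aₗ‖²` on `[0,T]`), `‖ξ‖²‖V t ξ‖ ≤ C` for `‖ξ‖ ≤ R`,
`t ∈ [0,T]`: `‖V(t,ξ)‖ ≤ ‖a(ξ)‖ + 36π‖ξ‖Λt` (`TightEnvelope.norm_le_of_energy`: Duhamel at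
`s = 0`, `heat ≤ 1`, `‖N(V,V)(ξ)‖ ≤ 36π‖ξ‖Λ` with `Λ = ∫∑ₗ‖aₗ‖² ≥ ∫‖V(r)‖²` for the sup norm on
`ℂ³`), whence `‖ξ‖²‖V t ξ‖ ≤ R²(A₀ + 36π|R|ΛT₀)` with `‖a‖_∞ ≤ A₀` (`hasDecay_fourierData 0`)
(Lemarié-Rieusset 2016, proof of Thm. 8.21, low-frequency half). -/
theorem lowFreqOfEnergy :
    ∀ ν : ℝ, 0 < ν →
      ∀ (u₀ : EuclideanSpace ℝ (Fin 3) → EuclideanSpace ℝ (Fin 3)) (hu : ContDiff ℝ (⊤ : ℕ∞) u₀)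
        (hd : Literature.Analysis.FluidPDE.HasRapidSpatialDecay u₀),
        Literature.Analysis.FluidPDE.NSWave0.IsDivFree u₀ →
      ∀ T₀ : ℝ, 0 < T₀ → ∀ R : ℝ, ∃ C : ℝ, ∀ T : ℝ, T ≤ T₀ →
        ∀ V : ℝ → EuclideanSpace ℝ (Fin 3) → Fin 3 → ℂ,
          Literature.Analysis.FluidPDE.FourierNS.IsFourierMild (4 * Real.pi ^ 2 * ν) 4 0 T V →
          V 0 = Literature.Analysis.FluidPDE.FourierNS.fourierData hu hd →
          (∀ t ∈ Set.Icc 0 T, ∫ η, ∑ l, ‖V t η l‖ ^ 2 ≤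
              ∫ η, ∑ l, ‖Literature.Analysis.FluidPDE.FourierNS.fourierData hu hd η l‖ ^ 2) →
          ∀ t ∈ Set.Icc 0 T, ∀ ξ : EuclideanSpace ℝ (Fin 3), ‖ξ‖ ≤ R → ‖ξ‖ ^ 2 * ‖V t ξ‖ ≤ C := by
  intro ν _hν u₀ hu hd _hdiv T₀ _hT₀ R
  obtain ⟨A₀, hA₀⟩ := hasDecay_fourierData hu hd 0
  set Λ : ℝ := ∫ η, ∑ l, ‖fourierData hu hd η l‖ ^ 2 with hΛ
  have hΛ0 : 0 ≤ Λ := integral_nonneg fun η => Finset.sum_nonneg fun l _ => sq_nonneg _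
  refine ⟨R ^ 2 * (A₀ + 36 * Real.pi * |R| * Λ * T₀), ?_⟩
  intro T hT V hV hV0 hE t ht ξ hξ
  -- the energy in the sup norm on `ℂ³` is below the componentwise energy, hence below `Λ`
  have hE' : ∀ r ∈ Set.Icc 0 T, ∫ η, ‖V r η‖ ^ 2 ≤ Λ := by
    intro r hr
    refine le_trans ?_ (hE r hr)
    obtain ⟨A, -, hA⟩ := hV.decay₀
    have hint : Integrable (fun η => ∑ l, ‖V r η l‖ ^ 2) :=
      integrable_finsetSum _ fun l _ =>
        integrable_norm_sq_of_hasDecay hV.hK₀ ((hA r).apply l)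
          ((continuous_apply l).comp (hV.continuous_slice r)).aestronglyMeasurable
    exact integral_mono_of_nonneg (Eventually.of_forall fun η => sq_nonneg _) hint
      (Eventually.of_forall fun η => norm_sq_le_sum_norm_sq (V r η))
  -- the low-frequency pointwise bound of the tree
  have h1 := Summit.NavierStokesRegularity.NavierStokesRegularity.Theorems.TightEnvelope.norm_le_of_energy
    hV hE' ht ξ
  have h2 : ‖V 0 ξ‖ ≤ A₀ := by rw [hV0]; exact hA₀.norm_le ξ
  have hξR : ‖ξ‖ ≤ |R| := hξ.trans (le_abs_self R)
  have htT : t ≤ T₀ := ht.2.trans hT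
  have h3 : 36 * Real.pi * ‖ξ‖ * Λ * t ≤ 36 * Real.pi * |R| * Λ * T₀ :=
    mul_le_mul (by gcongr) htT ht.1 (by positivity)
  have h4 : ‖V t ξ‖ ≤ A₀ + 36 * Real.pi * |R| * Λ * T₀ := by linarith
  have h5 : ‖ξ‖ ^ 2 ≤ R ^ 2 := pow_le_pow_left₀ (norm_nonneg ξ) hξ 2
  exact mul_le_mul h5 h4 (norm_nonneg _) (sq_nonneg R)

/-- **Low-frequency control along every mild solution from the datum.** For every `ν > 0`, Clay
datum `u₀`, horizon `T₀ > 0` and radius `R` there is `C = C(ν,u₀,T₀,R)` with `‖ξ‖² ‖V t ξ‖ ≤ C`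
for `‖ξ‖ ≤ R`, `t ∈ [0,T]`, along EVERY Fourier-mild solution `V` on `[0,T]`, `T ≤ T₀`, from the
Fourier datum: the energy inequality `energyIneq` (with `V 0 = a`) feeds the energy hypothesis of
`lowFreqOfEnergy`. -/
theorem lowFrequencyControl :
    ∀ ν : ℝ, 0 < ν →
      ∀ (u₀ : EuclideanSpace ℝ (Fin 3) → EuclideanSpace ℝ (Fin 3)) (hu : ContDiff ℝ (⊤ : ℕ∞) u₀)
        (hd : Literature.Analysis.FluidPDE.HasRapidSpatialDecay u₀),
        Literature.Analysis.FluidPDE.NSWave0.IsDivFree u₀ →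
      ∀ T₀ : ℝ, 0 < T₀ → ∀ R : ℝ, ∃ C : ℝ, ∀ T : ℝ, T ≤ T₀ →
        ∀ V : ℝ → EuclideanSpace ℝ (Fin 3) → Fin 3 → ℂ,
          Literature.Analysis.FluidPDE.FourierNS.IsFourierMild (4 * Real.pi ^ 2 * ν) 4 0 T V →
          V 0 = Literature.Analysis.FluidPDE.FourierNS.fourierData hu hd →
          ∀ t ∈ Set.Icc 0 T, ∀ ξ : EuclideanSpace ℝ (Fin 3), ‖ξ‖ ≤ R → ‖ξ‖ ^ 2 * ‖V t ξ‖ ≤ C := by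
  intro ν hν u₀ hu hd hdiv T₀ hT₀ R
  obtain ⟨C, hC⟩ := lowFreqOfEnergy ν hν u₀ hu hd hdiv T₀ hT₀ R
  refine ⟨C, fun T hT V hV hV0 t ht ξ hξ => hC T hT V hV hV0 (fun s hs => ?_) t ht ξ hξ⟩
  have hE := energyIneq _ _ _ _ V hV s hs
  rw [hV0] at hE
  exact hE

/-- **The crux from its high-frequency branch** (the line's composition, with the only open stub
as a hypothesis): if for every `ν, u₀, T₀` there are `R, C_high` such that the datum, whenever it
admits some Fourier-mild solution on `[0,T]`, `T ≤ T₀`, admits one with `‖ξ‖²‖W t ξ‖ ≤ C_high` for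
`‖ξ‖ ≥ R`, then `EnvelopeBound` holds: `C := max C_low(R) C_high`; for `‖ξ‖ ≤ R` the bound
`lowFrequencyControl` applies to `V` itself, for `‖ξ‖ ≥ R` the branch `W` coincides with `V` on
`[0,T]` by `stub_mildUnique`. -/
theorem envelopeBound_of_highFrequencyBranch
    (hbranch : ∀ ν : ℝ, 0 < ν →
      ∀ (u₀ : EuclideanSpace ℝ (Fin 3) → EuclideanSpace ℝ (Fin 3)) (hu : ContDiff ℝ (⊤ : ℕ∞) u₀)
        (hd : Literature.Analysis.FluidPDE.HasRapidSpatialDecay u₀),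
        Literature.Analysis.FluidPDE.NSWave0.IsDivFree u₀ →
      ∀ T₀ : ℝ, 0 < T₀ → ∃ R C : ℝ, ∀ T : ℝ, T ≤ T₀ →
        (∃ V : ℝ → EuclideanSpace ℝ (Fin 3) → Fin 3 → ℂ,
          Literature.Analysis.FluidPDE.FourierNS.IsFourierMild (4 * Real.pi ^ 2 * ν) 4 0 T V ∧
          V 0 = Literature.Analysis.FluidPDE.FourierNS.fourierData hu hd) →
        ∃ W : ℝ → EuclideanSpace ℝ (Fin 3) → Fin 3 → ℂ,
          Literature.Analysis.FluidPDE.FourierNS.IsFourierMild (4 * Real.pi ^ 2 * ν) 4 0 T W ∧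
          W 0 = Literature.Analysis.FluidPDE.FourierNS.fourierData hu hd ∧
          ∀ t ∈ Set.Icc 0 T, ∀ ξ : EuclideanSpace ℝ (Fin 3), R ≤ ‖ξ‖ → ‖ξ‖ ^ 2 * ‖W t ξ‖ ≤ C) :
    Summit.NavierStokesRegularity.NavierStokesRegularity.Theses.FrozenSignCascade.EnvelopeBound := by
  intro ν hν u₀ hu hd hdiv T₀ hT₀
  obtain ⟨R, Chi, hhi⟩ := hbranch ν hν u₀ hu hd hdiv T₀ hT₀
  obtain ⟨Clo, hlo⟩ := lowFrequencyControl ν hν u₀ hu hd hdiv T₀ hT₀ R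
  refine ⟨max Clo Chi, ?_⟩
  intro T hT V hV hV0 t ht ξ
  rcases le_total ‖ξ‖ R with hξ | hξ
  · exact (hlo T hT V hV hV0 t ht ξ hξ).trans (le_max_left _ _)
  · obtain ⟨W, hW, hW0, hWb⟩ := hhi T hT ⟨V, hV, hV0⟩
    have hVW : V t = W t :=
      stub_mildUnique _ _ _ _ _ V W hV hW (hV0.trans hW0.symm) t ht.1 ht.2 ht.2
    rw [congrFun hVW ξ]
    exact (hWb t ht ξ hξ).trans (le_max_right _ _)

/-- **The high-frequency branch from the crux** (trivial direction): under `EnvelopeBound` the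
given solution is itself a branch with bounded envelope at all frequencies (`R := 0`). -/
theorem highFrequencyBranch_of_envelopeBound
    (hA : Summit.NavierStokesRegularity.NavierStokesRegularity.Theses.FrozenSignCascade.EnvelopeBound) :
    ∀ ν : ℝ, 0 < ν →
      ∀ (u₀ : EuclideanSpace ℝ (Fin 3) → EuclideanSpace ℝ (Fin 3)) (hu : ContDiff ℝ (⊤ : ℕ∞) u₀)
        (hd : Literature.Analysis.FluidPDE.HasRapidSpatialDecay u₀),
        Literature.Analysis.FluidPDE.NSWave0.IsDivFree u₀ →
      ∀ T₀ : ℝ, 0 < T₀ → ∃ R C : ℝ, ∀ T : ℝ, T ≤ T₀ →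
        (∃ V : ℝ → EuclideanSpace ℝ (Fin 3) → Fin 3 → ℂ,
          Literature.Analysis.FluidPDE.FourierNS.IsFourierMild (4 * Real.pi ^ 2 * ν) 4 0 T V ∧
          V 0 = Literature.Analysis.FluidPDE.FourierNS.fourierData hu hd) →
        ∃ W : ℝ → EuclideanSpace ℝ (Fin 3) → Fin 3 → ℂ,
          Literature.Analysis.FluidPDE.FourierNS.IsFourierMild (4 * Real.pi ^ 2 * ν) 4 0 T W ∧
          W 0 = Literature.Analysis.FluidPDE.FourierNS.fourierData hu hd ∧
          ∀ t ∈ Set.Icc 0 T, ∀ ξ : EuclideanSpace ℝ (Fin 3), R ≤ ‖ξ‖ → ‖ξ‖ ^ 2 * ‖W t ξ‖ ≤ C := by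
  intro ν hν u₀ hu hd hdiv T₀ hT₀
  obtain ⟨C, hC⟩ := hA ν hν u₀ hu hd hdiv T₀ hT₀
  refine ⟨0, C, fun T hT hex => ?_⟩
  obtain ⟨V, hV, hV0⟩ := hex
  exact ⟨V, hV, hV0, fun t ht ξ _ => hC T hT V hV hV0 t ht ξ⟩

/-- **REDUCTION: the crux `EnvelopeBound` is equivalent to its high-frequency branch.** For
every `ν > 0`, Clay datum `u₀` and horizon `T₀ > 0`: a uniform bound of the critical Fourier
envelope `‖ξ‖²‖V t ξ‖` along all Fourier-mild solutions on `[0,T]`, `T ≤ T₀`, from the datum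
(`EnvelopeBound`) holds if and only if there are `R, C` such that, whenever the datum admits some
Fourier-mild solution on `[0,T]`, `T ≤ T₀`, it admits one whose envelope is bounded by `C` at the
frequencies `‖ξ‖ ≥ R`. The low frequencies and the transfer to every solution are supplied by the
energy inequality and by uniqueness in the Fourier-mild class, both proved. -/
theorem envelopeBound_iff_highFrequencyBranch :
    Summit.NavierStokesRegularity.NavierStokesRegularity.Theses.FrozenSignCascade.EnvelopeBound ↔
    ∀ ν : ℝ, 0 < ν →
      ∀ (u₀ : EuclideanSpace ℝ (Fin 3) → EuclideanSpace ℝ (Fin 3)) (hu : ContDiff ℝ (⊤ : ℕ∞) u₀)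
        (hd : Literature.Analysis.FluidPDE.HasRapidSpatialDecay u₀),
        Literature.Analysis.FluidPDE.NSWave0.IsDivFree u₀ →
      ∀ T₀ : ℝ, 0 < T₀ → ∃ R C : ℝ, ∀ T : ℝ, T ≤ T₀ →
        (∃ V : ℝ → EuclideanSpace ℝ (Fin 3) → Fin 3 → ℂ,
          Literature.Analysis.FluidPDE.FourierNS.IsFourierMild (4 * Real.pi ^ 2 * ν) 4 0 T V ∧
          V 0 = Literature.Analysis.FluidPDE.FourierNS.fourierData hu hd) →
        ∃ W : ℝ → EuclideanSpace ℝ (Fin 3) → Fin 3 → ℂ,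
          Literature.Analysis.FluidPDE.FourierNS.IsFourierMild (4 * Real.pi ^ 2 * ν) 4 0 T W ∧
          W 0 = Literature.Analysis.FluidPDE.FourierNS.fourierData hu hd ∧
          ∀ t ∈ Set.Icc 0 T, ∀ ξ : EuclideanSpace ℝ (Fin 3), R ≤ ‖ξ‖ → ‖ξ‖ ^ 2 * ‖W t ξ‖ ≤ C :=
  ⟨highFrequencyBranch_of_envelopeBound, envelopeBound_of_highFrequencyBranch⟩

end Summit.NavierStokesRegularity.NavierStokesRegularity.Theorems.EnvelopeBound.Registered

end
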